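import Literature.Computability.AlgebraicComplexity.ConstituentStageData
import HarnessLib

/-!
# Usefulness, typicalness and compatibility one level down, and Claim 6.10
(Vassilevska Williams–Xu–Xu–Zhou 2024, §6.3–§6.5: `S_{t,*,*,k'}`, `β̄_{Z,t,*,*,k'}`, Def. 6.9
(compatibility), Claim 6.10, Def. 6.11 (usefulness), `𝒯*`) — proved

Topic `Literature/Computability/AlgebraicComplexity`.  The constituent stage (§6 of Vassilevska
Williams–Xu–Xu–Zhou, *New bounds for matrix multiplication: from alpha to omega*, SODA 2024,
arXiv:2307.07970) repeats the compatibility / uniqueness / usefulness zero-outs of §5.3–§5.5 one level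
down, with the position classes `S_{t,i',j',k'}` of a level-`(ℓ−1)` block triple `(I, J, K)` refined by
the level-`ℓ` term `t` (`ConstituentStageData.pairClass`) and the classes
`S_{t,*,*,k'} = {p in the t-th term | K_p = k'}`.  This file vendors that vocabulary and PROVES the
facts about it that the structure theorem needs (the §5 counterparts are in `LevelTriples.lean`):

* `pairClassZ` (`S_{t,*,*,k'}`), `boxTriples` (the constituent triples `(i',j',k') ≤ (i_t,j_t,k_t)` with
  third coordinate `k'`), `card_filter_pairClassZ_eq_sum` — for a triple inside the level-`ℓ` blocks,
  `S_{t,*,*,k'}` is the disjoint union of the `S_{t,i',j',k'}` over the box;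
* `betaBarZ` — **`β̄_{Z,t,*,*,k'} = ∑ (α_t(i',j',k') + α_t(i_t−i',j_t−j',k_t−k')) β_{Z,t,i',j',k'} / ∑ (…)`**
  (§6.3), with the weights given as the counts `cnt t (i',j',k') = #left(t,(i',j',k'))` of an
  `{α_t}`-consistent triple;
* `IsUsefulFor₂` (**Def. 6.11**), `IsTypical₂`, `IsCompatibleWith₂` (**Def. 6.9**: the classes with
  `i' = 0` or `j' = 0`, and typicalness on every `S_{t,*,*,k'}`);
* `IsUsefulFor₂.isTypical₂`, `IsUsefulFor₂.isCompatibleWith₂` — **a useful `Z`-block of an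
  `{α_t}`-consistent triple inside the level-`ℓ` blocks is typical, hence compatible** (the averaging
  identity `completeSplitOn_pairClassZ_mul_card` and `|S_{t,i',j',k'}| = cnt + cnt̄`,
  `ConstituentStageData.card_pairClass_eq`);
* `compatible_fst_of_useful₂` — **Claim 6.10** ("the proof of this claim is the same as
  (cl:global:compatible)"), in combinatorial form: for complementary level-1 sequences `Î + Ĵ + K̂ = 2⃗`
  with `Î`, `Ĵ` useful for the `X`-, `Y`-data of the triple of their blocks, `split(K̂, S_{t,i',j',k'}) =
  β_{Z,t,i',j',k'}` on every occurring class with `i' = 0` or `j' = 0`, under Remark 5.2's convention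
  `β_{Z,t,i',0,k'}(L) = β_{X,t,i',0,k'}(2⃗ − L)`, `β_{Z,t,0,j',k'}(L) = β_{Y,t,0,j',k'}(2⃗ − L)`;
* `mem_levelBlocksX/Y/Z_pair_iff` — **the level-1 blocks of `𝒯*` (`starTensor₂`) are the sequences in
  the block that are useful for the triple** (the §6 counterpart of Claim 5.11's identification).

Everything is proved; the definitions are the ones listed; no named facts.

## References

* V. Vassilevska Williams, Y. Xu, Z. Xu, R. Zhou, *New bounds for matrix multiplication: from alpha
  to omega*, SODA 2024, arXiv:2307.07970 (held: `paper:arxiv-2307.07970`), §6.3 (S_{t,i',j',k'},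
  S_{t,*,*,k'}, β̄, Def. 6.9, Claim 6.10), §6.5 (Def. 6.11, 𝒯*), and Claim 5.9 / Claim 5.11 (proofs).
  [VassilevskaWilliamsXuXuZhou2024]
-/

noncomputable section

open scoped BigOperators
open Finset

namespace Literature.Computability.AlgebraicComplexity

/-! ## The classes `S_{t,*,*,k'}` and the box of constituent triples -/

section Classes

variable {c n s : ℕ} (τ : Fin n → Fin s)

/-- **`S_{t,*,*,k'}`**: the half-chunk positions of term `t` with `K_p = k'`. [cite: VassilevskaWilliamsXuXuZhou2024, §6.3 (S^{(K)}_{t,*,*,k'})] -/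
def pairClassZ (K : Fin (n + n) → ℕ) (t : Fin s) (k : ℕ) : Finset (Fin (n + n)) :=
  univ.filter fun p => halfTermOf τ p = t ∧ K p = k

/-- Membership. [folklore] -/
@[simp] theorem mem_pairClassZ {K : Fin (n + n) → ℕ} {t : Fin s} {k : ℕ} {p : Fin (n + n)} :
    p ∈ pairClassZ τ K t k ↔ halfTermOf τ p = t ∧ K p = k := by
  simp [pairClassZ]

/-- `S_{t,i',j',k'} ⊆ S_{t,*,*,k'}`. [cite: VassilevskaWilliamsXuXuZhou2024, §6.3] -/
theorem pairClass_subset_pairClassZ (I J K : Fin (n + n) → ℕ) (t : Fin s) (i j k : ℕ) :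
    pairClass τ I J K t i j k ⊆ pairClassZ τ K t k := by
  intro p hp
  rw [mem_pairClass] at hp
  exact mem_pairClassZ τ|>.2 ⟨hp.1, hp.2.2.2⟩

/-- Classes of non-constituent triples are empty. [cite: VassilevskaWilliamsXuXuZhou2024, §6.3 (i'+j'+k' = 2^{ℓ−1})] -/
theorem pairClass_eq_empty {I J K : Fin (n + n) → ℕ} (h : IsLevelTriple c I J K) {i j k : ℕ} (hijk : i + j + k ≠ 2 * c) (t : Fin s) :
    pairClass τ I J K t i j k = ∅ := by
  rw [Finset.eq_empty_iff_forall_notMem]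
  intro p hp
  rw [mem_pairClass] at hp
  obtain ⟨-, h1, h2, h3⟩ := hp
  exact hijk (by rw [← h1, ← h2, ← h3]; exact h p)

/-- **The box**: the constituent triples `(i',j',k') ≤ (i_t,j_t,k_t)` (componentwise) with third
coordinate `k'` — the index set of the sums defining `β̄_{Z,t,*,*,k'}` and of Def. 6.9. [cite: VassilevskaWilliamsXuXuZhou2024, Def. 6.9 ("(i',j',k') ∈ ℤ³_{≥0} ∩ [0,i_t]×[0,j_t]×[0,k_t] with i'+j'+k' = 2^{ℓ−1}")] -/
def boxTriples (c : ℕ) (T : InterfaceTerm (c + c)) (k : ℕ) : Finset (ℕ × ℕ × ℕ) :=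
  (constituentTriples c).filter fun ijk => ijk.2.2 = k ∧ ijk.1 ≤ T.i ∧ ijk.2.1 ≤ T.j ∧ ijk.2.2 ≤ T.k

omit τ in
/-- Membership in the box. [folklore] -/
theorem mem_boxTriples {T : InterfaceTerm (c + c)} {k : ℕ} {ijk : ℕ × ℕ × ℕ} :
    ijk ∈ boxTriples c T k ↔ ijk.1 + ijk.2.1 + ijk.2.2 = 2 * c ∧ ijk.2.2 = k ∧ ijk.1 ≤ T.i ∧ ijk.2.1 ≤ T.j ∧ ijk.2.2 ≤ T.k := by
  rw [boxTriples, mem_filter, mem_constituentTriples]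

variable (L : Fin s → InterfaceTerm (c + c))

/-- For a level triple inside the level-`ℓ` blocks, the constituent triple at a position of term `t` with
`K_p = k'` lies in the box. [cite: VassilevskaWilliamsXuXuZhou2024, §6.3] -/
theorem triple_mem_boxTriples {I J K : Fin (n + n) → ℕ} (h : IsLevelTriple c I J K)
    (hI : ∀ u, I (Fin.castAdd n u) + I (Fin.natAdd n u) = (L (τ u)).i)
    (hJ : ∀ u, J (Fin.castAdd n u) + J (Fin.natAdd n u) = (L (τ u)).j)
    (hK : ∀ u, K (Fin.castAdd n u) + K (Fin.natAdd n u) = (L (τ u)).k) (p : Fin (n + n)) :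
    (I p, J p, K p) ∈ boxTriples c (L (halfTermOf τ p)) (K p) := by
  rw [mem_boxTriples]
  refine ⟨h p, rfl, ?_⟩
  refine Fin.addCases (motive := fun p => I p ≤ (L (halfTermOf τ p)).i ∧ J p ≤ (L (halfTermOf τ p)).j ∧ K p ≤ (L (halfTermOf τ p)).k)
    (fun u => ?_) (fun u => ?_) p
  · rw [halfTermOf_castAdd]
    have h1 := hI u; have h2 := hJ u; have h3 := hK u
    omega
  · rw [halfTermOf_natAdd]
    have h1 := hI u; have h2 := hJ u; have h3 := hK u
    omega

/-- **`S_{t,*,*,k'}` decomposes over the box**: for a level triple inside the level-`ℓ` blocks and any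
predicate `Q` on positions, `#{p ∈ S_{t,*,*,k'} | Q p} = ∑_{(i',j',k') ∈ box} #{p ∈ S_{t,i',j',k'} | Q p}`.
[cite: VassilevskaWilliamsXuXuZhou2024, §6.3 (S_{t,*,*,k} := ⋃_{i,j} S_{t,i,j,k}) and Claim 5.11 (proof, the averaging)] -/
theorem card_filter_pairClassZ_eq_sum {I J K : Fin (n + n) → ℕ} (h : IsLevelTriple c I J K)
    (hI : ∀ u, I (Fin.castAdd n u) + I (Fin.natAdd n u) = (L (τ u)).i)
    (hJ : ∀ u, J (Fin.castAdd n u) + J (Fin.natAdd n u) = (L (τ u)).j)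
    (hK : ∀ u, K (Fin.castAdd n u) + K (Fin.natAdd n u) = (L (τ u)).k)
    (t : Fin s) (k : ℕ) (Q : Fin (n + n) → Prop) [DecidablePred Q] :
    ((pairClassZ τ K t k).filter Q).card =
      ∑ ijk ∈ boxTriples c (L t) k, ((pairClass τ I J K t ijk.1 ijk.2.1 ijk.2.2).filter Q).card := by
  rw [card_eq_sum_card_fiberwise (f := fun p => (I p, J p, K p)) (s := (pairClassZ τ K t k).filter Q)
    (t := boxTriples c (L t) k) ?_]
  · refine sum_congr rfl fun ijk hijk => ?_
    obtain ⟨i, j, k'⟩ := ijk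
    rw [mem_boxTriples] at hijk
    have hk' : k' = k := hijk.2.1
    congr 1
    ext p
    simp only [mem_filter, mem_pairClassZ, mem_pairClass, Prod.mk.injEq]
    constructor
    · rintro ⟨⟨⟨ht, -⟩, hq⟩, h1, h2, h3⟩
      exact ⟨⟨ht, h1, h2, h3⟩, hq⟩
    · rintro ⟨⟨ht, h1, h2, h3⟩, hq⟩
      exact ⟨⟨⟨ht, h3.trans hk'⟩, hq⟩, h1, h2, h3⟩
  · intro p hp
    have hp' := mem_filter.1 hp
    obtain ⟨ht, hk⟩ := mem_pairClassZ τ|>.1 hp'.1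
    show (I p, J p, K p) ∈ boxTriples c (L t) k
    rw [← hk, ← ht]
    exact triple_mem_boxTriples τ L h hI hJ hK p

/-- **The averaging identity**: `split(K̂, S_{t,*,*,k'})(σ) · |S_{t,*,*,k'}| = ∑_{box} split(K̂, S_{t,i',j',k'})(σ) · |S_{t,i',j',k'}|`.
[cite: VassilevskaWilliamsXuXuZhou2024, Claim 5.11 (proof: "split(K̂, S_{*,*,k}) = (1/∑α) ∑ α · split(K̂, S_{i,j,k})"), used in §6.5] -/
theorem completeSplitOn_pairClassZ_mul_card {I J K : Fin (n + n) → ℕ} (h : IsLevelTriple c I J K)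
    (hI : ∀ u, I (Fin.castAdd n u) + I (Fin.natAdd n u) = (L (τ u)).i)
    (hJ : ∀ u, J (Fin.castAdd n u) + J (Fin.natAdd n u) = (L (τ u)).j)
    (hK : ∀ u, K (Fin.castAdd n u) + K (Fin.natAdd n u) = (L (τ u)).k)
    (Kh : Fin (n + n) → Fin c → Fin 3) (t : Fin s) (k : ℕ) (σ : Fin c → Fin 3) :
    completeSplitOn Kh (pairClassZ τ K t k) σ * (pairClassZ τ K t k).card =
      ∑ ijk ∈ boxTriples c (L t) k, completeSplitOn Kh (pairClass τ I J K t ijk.1 ijk.2.1 ijk.2.2) σ *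
        (pairClass τ I J K t ijk.1 ijk.2.1 ijk.2.2).card := by
  rw [completeSplitOn_mul_card, card_filter_pairClassZ_eq_sum τ L h hI hJ hK t k (fun p => Kh p = σ)]
  push_cast
  exact sum_congr rfl fun ijk _ => (completeSplitOn_mul_card Kh _ σ).symm

/-- `|S_{t,*,*,k'}| = ∑_{box} |S_{t,i',j',k'}|`. [cite: VassilevskaWilliamsXuXuZhou2024, §6.3] -/
theorem card_pairClassZ_eq_sum {I J K : Fin (n + n) → ℕ} (h : IsLevelTriple c I J K)
    (hI : ∀ u, I (Fin.castAdd n u) + I (Fin.natAdd n u) = (L (τ u)).i)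
    (hJ : ∀ u, J (Fin.castAdd n u) + J (Fin.natAdd n u) = (L (τ u)).j)
    (hK : ∀ u, K (Fin.castAdd n u) + K (Fin.natAdd n u) = (L (τ u)).k) (t : Fin s) (k : ℕ) :
    (pairClassZ τ K t k).card = ∑ ijk ∈ boxTriples c (L t) k, (pairClass τ I J K t ijk.1 ijk.2.1 ijk.2.2).card := by
  have := card_filter_pairClassZ_eq_sum τ L h hI hJ hK t k (fun _ => True)
  simpa using this

end Classes

/-! ## `β̄_{Z,t,*,*,k'}`, usefulness, typicalness, compatibility -/

section Compatibility

variable {c n s : ℕ} (τ : Fin n → Fin s)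

/-- **`β̄_{Z,t,*,*,k'}`** (§6.3): the weighted average, over the box, of the `β_{Z,t,i',j',k'}` with weights
`α_t(i',j',k') + α_t(i_t−i',j_t−j',k_t−k')` — here with the weights given as real numbers `w (i',j',k')`
(for an `{α_t}`-consistent triple: `w = cnt t = #left(t,·)`, proportional to `α_t`). [cite: VassilevskaWilliamsXuXuZhou2024, §6.3 (β̄_{Z,t,*,*,k'})] -/
def betaBarZ (c : ℕ) (T : InterfaceTerm (c + c)) (w : ℕ × ℕ × ℕ → ℝ) (βZ : ℕ × ℕ × ℕ → (Fin c → Fin 3) → ℝ) (k : ℕ) :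
    (Fin c → Fin 3) → ℝ := fun σ =>
  (∑ ijk ∈ boxTriples c T k, (w ijk + w (T.i - ijk.1, T.j - ijk.2.1, T.k - ijk.2.2)) * βZ ijk σ) /
    ∑ ijk ∈ boxTriples c T k, (w ijk + w (T.i - ijk.1, T.j - ijk.2.1, T.k - ijk.2.2))

/-- **Def. 6.11 (usefulness)** of a level-1 sequence for the triple `(I,J,K)` w.r.t. the data `β_{W,t,·}`:
`split(Ŵ, S_{t,i',j',k'}) = β_{W,t,i',j',k'}` for all `t` and all (occurring) `(i',j',k')`.
[cite: VassilevskaWilliamsXuXuZhou2024, Def. 6.11] -/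
def IsUsefulFor₂ (β : Fin s → ℕ × ℕ × ℕ → (Fin c → Fin 3) → ℝ) (I J K : Fin (n + n) → ℕ) (Wh : Fin (n + n) → Fin c → Fin 3) : Prop :=
  ∀ t i j k, (pairClass τ I J K t i j k).Nonempty → completeSplitOn Wh (pairClass τ I J K t i j k) = β t (i, j, k)

/-- **Typicalness one level down** (the second item of Def. 6.9): `split(K̂, S_{t,*,*,k'}) = β̄_{Z,t,*,*,k'}`
for every `t` and every (occurring) `k'`. [cite: VassilevskaWilliamsXuXuZhou2024, Def. 6.9 (second item)] -/
def IsTypical₂ (L : Fin s → InterfaceTerm (c + c)) (w : Fin s → ℕ × ℕ × ℕ → ℝ) (βZ : Fin s → ℕ × ℕ × ℕ → (Fin c → Fin 3) → ℝ)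
    (K : Fin (n + n) → ℕ) (Kh : Fin (n + n) → Fin c → Fin 3) : Prop :=
  ∀ t k, (pairClassZ τ K t k).Nonempty → completeSplitOn Kh (pairClassZ τ K t k) = betaBarZ c (L t) (w t) (βZ t) k

/-- **Def. 6.9 (compatibility)** of `Z_K̂ ∈ Z_K` with the triple `(I,J,K)`: (1) `split(K̂, S_{t,i',j',k'}) =
β_{Z,t,i',j',k'}` on the occurring classes with `i' = 0` or `j' = 0`; (2) typicalness.
[cite: VassilevskaWilliamsXuXuZhou2024, Def. 6.9] -/
def IsCompatibleWith₂ (L : Fin s → InterfaceTerm (c + c)) (w : Fin s → ℕ × ℕ × ℕ → ℝ) (βZ : Fin s → ℕ × ℕ × ℕ → (Fin c → Fin 3) → ℝ)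
    (I J K : Fin (n + n) → ℕ) (Kh : Fin (n + n) → Fin c → Fin 3) : Prop :=
  (∀ t i j k, (i = 0 ∨ j = 0) → (pairClass τ I J K t i j k).Nonempty →
      completeSplitOn Kh (pairClass τ I J K t i j k) = βZ t (i, j, k)) ∧
    IsTypical₂ τ L w βZ K Kh

variable (L : Fin s → InterfaceTerm (c + c))

/-- **A useful `Z`-block of an `{α_t}`-consistent triple inside the level-`ℓ` blocks is typical**
(averaging: `split(K̂, S_{t,*,*,k'}) |S_{t,*,*,k'}| = ∑_box β_{Z,t,i',j',k'} |S_{t,i',j',k'}|` and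
`|S_{t,i',j',k'}| = cnt(i',j',k') + cnt(i_t−i',j_t−j',k_t−k')`). [cite: VassilevskaWilliamsXuXuZhou2024, Claim 5.11 (proof, "the third constraint implies the first"), §6.5] -/
theorem IsUsefulFor₂.isTypical₂ {βZ : Fin s → ℕ × ℕ × ℕ → (Fin c → Fin 3) → ℝ} {cnt : Fin s → ℕ × ℕ × ℕ → ℕ}
    {I J K : Fin (n + n) → Fin (2 * c + 1)} (h : IsLevelTriple c (seqVal I) (seqVal J) (seqVal K))
    (hI : InsideX τ L I) (hJ : InsideY τ L J) (hK : InsideZ τ L K) (hcnt : IsAlphaTConsistent τ cnt (seqVal I) (seqVal J) (seqVal K))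
    {Kh : Fin (n + n) → Fin c → Fin 3} (hu : IsUsefulFor₂ τ βZ (seqVal I) (seqVal J) (seqVal K) Kh) :
    IsTypical₂ τ L (fun t ijk => (cnt t ijk : ℝ)) βZ (seqVal K) Kh := by
  intro t k hne
  funext σ
  -- class sizes
  have hsize : ∀ ijk ∈ boxTriples c (L t) k,
      ((pairClass τ (seqVal I) (seqVal J) (seqVal K) t ijk.1 ijk.2.1 ijk.2.2).card : ℝ) =
        (cnt t ijk : ℝ) + cnt t ((L t).i - ijk.1, (L t).j - ijk.2.1, (L t).k - ijk.2.2) := by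
    intro ijk hijk
    rw [mem_boxTriples] at hijk
    rw [card_pairClass_eq τ L hI hJ hK t hijk.2.2.1 hijk.2.2.2.1 hijk.2.2.2.2, ← hcnt t ijk, ← hcnt t _]
    push_cast
    rfl
  have havg := completeSplitOn_pairClassZ_mul_card τ L h hI hJ hK Kh t k σ
  have hcard := card_pairClassZ_eq_sum τ L h hI hJ hK t k
  -- replace the splits on occurring classes by `β`
  have hterm : ∀ ijk ∈ boxTriples c (L t) k,
      completeSplitOn Kh (pairClass τ (seqVal I) (seqVal J) (seqVal K) t ijk.1 ijk.2.1 ijk.2.2) σ *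
          (pairClass τ (seqVal I) (seqVal J) (seqVal K) t ijk.1 ijk.2.1 ijk.2.2).card =
        ((cnt t ijk : ℝ) + cnt t ((L t).i - ijk.1, (L t).j - ijk.2.1, (L t).k - ijk.2.2)) * βZ t ijk σ := by
    intro ijk hijk
    rcases (pairClass τ (seqVal I) (seqVal J) (seqVal K) t ijk.1 ijk.2.1 ijk.2.2).eq_empty_or_nonempty with he | hne'
    · have h0 : ((cnt t ijk : ℝ) + cnt t ((L t).i - ijk.1, (L t).j - ijk.2.1, (L t).k - ijk.2.2)) = 0 := by
        rw [← hsize ijk hijk, he, card_empty, Nat.cast_zero]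
      rw [he, card_empty, Nat.cast_zero, mul_zero, h0, zero_mul]
    · rw [hu t _ _ _ hne', hsize ijk hijk, mul_comm]
  rw [sum_congr rfl hterm] at havg
  have hpos : (0 : ℝ) < (pairClassZ τ (seqVal K) t k).card := by exact_mod_cast hne.card_pos
  have hW : ((pairClassZ τ (seqVal K) t k).card : ℝ) =
      ∑ ijk ∈ boxTriples c (L t) k, ((cnt t ijk : ℝ) + cnt t ((L t).i - ijk.1, (L t).j - ijk.2.1, (L t).k - ijk.2.2)) := by
    rw [hcard]; push_cast
    exact sum_congr rfl hsize
  simp only [betaBarZ]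
  rw [eq_div_iff (by rw [← hW]; exact hpos.ne'), ← hW]
  exact havg

/-- Hence **a useful `Z`-block of an `{α_t}`-consistent triple inside the level-`ℓ` blocks is compatible
with it.** [cite: VassilevskaWilliamsXuXuZhou2024, §6.5 (Def. 6.11) and Claim 5.11 (proof)] -/
theorem IsUsefulFor₂.isCompatibleWith₂ {βZ : Fin s → ℕ × ℕ × ℕ → (Fin c → Fin 3) → ℝ} {cnt : Fin s → ℕ × ℕ × ℕ → ℕ}
    {I J K : Fin (n + n) → Fin (2 * c + 1)} (h : IsLevelTriple c (seqVal I) (seqVal J) (seqVal K))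
    (hI : InsideX τ L I) (hJ : InsideY τ L J) (hK : InsideZ τ L K) (hcnt : IsAlphaTConsistent τ cnt (seqVal I) (seqVal J) (seqVal K))
    {Kh : Fin (n + n) → Fin c → Fin 3} (hu : IsUsefulFor₂ τ βZ (seqVal I) (seqVal J) (seqVal K) Kh) :
    IsCompatibleWith₂ τ L (fun t ijk => (cnt t ijk : ℝ)) βZ (seqVal I) (seqVal J) (seqVal K) Kh :=
  ⟨fun t i j k _ hne => hu t i j k hne, hu.isTypical₂ τ L h hI hJ hK hcnt⟩

end Compatibility

/-! ## Claim 6.10: compatibility of `K̂` with the triple of `Î`, `Ĵ` -/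

section Claim610

variable {c n s : ℕ} (τ : Fin n → Fin s)

omit τ in
/-- On a chunk whose `Y`-shape is `0⃗`, complementary shapes satisfy `K̂ = 2⃗ − Î`. [cite: VassilevskaWilliamsXuXuZhou2024, Claim 5.9 (proof)] -/
theorem eq_rev_of_add_eq_two {Ih Jh Kh : Fin (n + n) → Fin c → Fin 3} (hsum : ∀ p r, (Ih p r : ℕ) + Jh p r + Kh p r = 2)
    {p : Fin (n + n)} (hp : chunkLevels Jh p = 0) : Kh p = fun r => (Ih p r).rev := by
  funext r
  have h0 : Jh p r = 0 := pattern_eq_zero_of_patternLevel_eq_zero (by simpa using hp) r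
  have h2 := hsum p r
  rw [h0] at h2
  apply Fin.ext
  rw [Fin.val_rev]
  have := (Ih p r).isLt
  simp only [Fin.val_zero, add_zero] at h2
  omega

omit τ in
/-- On a chunk whose `X`-shape is `0⃗`, complementary shapes satisfy `K̂ = 2⃗ − Ĵ`. [cite: VassilevskaWilliamsXuXuZhou2024, Claim 5.9 (proof)] -/
theorem eq_rev_of_add_eq_two' {Ih Jh Kh : Fin (n + n) → Fin c → Fin 3} (hsum : ∀ p r, (Ih p r : ℕ) + Jh p r + Kh p r = 2)
    {p : Fin (n + n)} (hp : chunkLevels Ih p = 0) : Kh p = fun r => (Jh p r).rev := by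
  funext r
  have h0 : Ih p r = 0 := pattern_eq_zero_of_patternLevel_eq_zero (by simpa using hp) r
  have h2 := hsum p r
  rw [h0] at h2
  apply Fin.ext
  rw [Fin.val_rev]
  have := (Jh p r).isLt
  simp only [Fin.val_zero, zero_add] at h2
  omega

/-- **VXXZ Claim 6.10** (combinatorial form of "the proof is the same as Claim 5.9"): for complementary
level-1 sequences `Î + Ĵ + K̂ = 2⃗` on the half-chunk positions, if `Î` is useful for the `X`-data and `Ĵ`
for the `Y`-data of the triple `(I,J,K)` of their blocks, and the `Z`-data follows Remark 5.2's
convention on the classes with `j' = 0`, resp. `i' = 0`, then `split(K̂, S_{t,i',j',k'}) = β_{Z,t,i',j',k'}`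
on every occurring class with `i' = 0` or `j' = 0`. [cite: VassilevskaWilliamsXuXuZhou2024, Claim 6.10 (via Claim 5.9) and Remark 5.2] -/
theorem compatible_fst_of_useful₂ {βX βY βZ : Fin s → ℕ × ℕ × ℕ → (Fin c → Fin 3) → ℝ}
    (hZX : ∀ t i k σ, βZ t (i, 0, k) σ = βX t (i, 0, k) (fun r => (σ r).rev))
    (hZY : ∀ t j k σ, βZ t (0, j, k) σ = βY t (0, j, k) (fun r => (σ r).rev))
    {Ih Jh Kh : Fin (n + n) → Fin c → Fin 3} (hsum : ∀ p r, (Ih p r : ℕ) + Jh p r + Kh p r = 2)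
    (hx : IsUsefulFor₂ τ βX (chunkLevels Ih) (chunkLevels Jh) (chunkLevels Kh) Ih)
    (hy : IsUsefulFor₂ τ βY (chunkLevels Ih) (chunkLevels Jh) (chunkLevels Kh) Jh)
    (t : Fin s) (i j k : ℕ) (hij : i = 0 ∨ j = 0)
    (hne : (pairClass τ (chunkLevels Ih) (chunkLevels Jh) (chunkLevels Kh) t i j k).Nonempty) :
    completeSplitOn Kh (pairClass τ (chunkLevels Ih) (chunkLevels Jh) (chunkLevels Kh) t i j k) = βZ t (i, j, k) := by
  rcases hij with rfl | rfl
  · funext σ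
    rw [completeSplitOn_rev_on (I := Jh) (fun p hp => eq_rev_of_add_eq_two' hsum (mem_pairClass τ|>.1 hp).2.1) σ,
      hy t 0 j k hne, hZY]
  · funext σ
    rw [completeSplitOn_rev_on (I := Ih) (fun p hp => eq_rev_of_add_eq_two hsum (mem_pairClass τ|>.1 hp).2.2.1) σ,
      hx t i 0 k hne, hZX]

end Claim610

/-! ## The level-1 blocks of `𝒯*` are the useful sequences in the block -/

section Identification

variable {c n s : ℕ} (τ : Fin n → Fin s)

/-- **The level-1 `X`-blocks of `𝒯*` over `(I,J,K)` are the `X`-sequences in `X_I` useful for the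
triple** (`chunkLevels Î = I` and `split(Î, S_{t,i',j',k'}) = β_{X,t,i',j',k'}` on occurring classes).
[cite: VassilevskaWilliamsXuXuZhou2024, §6.5 (𝒯*, Def. 6.11) and Claim 5.11 (proof)] -/
theorem mem_levelBlocksX_pair_iff {I J K : Fin (n + n) → ℕ} (h : IsLevelTriple c I J K)
    (βX βY βZ : Fin s → ℕ × ℕ × ℕ → (Fin c → Fin 3) → ℝ) (Ih : Fin (n + n) → Fin c → Fin 3) :
    Ih ∈ levelBlocksX (pairTermIdx τ h) (pairTermList c s βX βY βZ) 0 ↔ chunkLevels Ih = I ∧ IsUsefulFor₂ τ βX I J K Ih := by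
  rw [levelBlocksX, mem_admissibleSeqs]
  refine and_congr ?_ ?_
  · refine ⟨fun hl => funext fun p => ?_, fun hl p => ?_⟩
    · have := hl p
      rw [show pairTermIdx τ h p = finProdFinEquiv (halfTermOf τ p, tripleTermMap h p) from rfl, pairTermList_apply] at this
      simpa [tripleTermMap] using this
    · rw [show pairTermIdx τ h p = finProdFinEquiv (halfTermOf τ p, tripleTermMap h p) from rfl, pairTermList_apply]
      simpa [tripleTermMap] using congrFun hl p
  · constructor
    · intro hc t i j k hne
      by_cases hijk : i + j + k = 2 * c
      · set sidx := (constituentTriples c).equivFin ⟨(i, j, k), (mem_constituentTriples c).2 hijk⟩ with hsidx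
        have hs : (univ.filter fun p => pairTermIdx τ h p = finProdFinEquiv (t, sidx)) = pairClass τ I J K t i j k := by
          rw [filter_pairTermIdx_eq τ h t sidx]; simp [hsidx]
        have := hc (finProdFinEquiv (t, sidx)) (by rw [hs]; exact hne)
        rw [hs, splitConsistentOn_zero_iff, pairTermList_apply] at this
        simpa [hsidx] using this
      · exfalso
        rw [pairClass_eq_empty τ h hijk] at hne
        exact Finset.not_nonempty_empty hne
    · intro hu idx hne
      obtain ⟨⟨t, sidx⟩, rfl⟩ := finProdFinEquiv.surjective idx
      rw [filter_pairTermIdx_eq τ h t sidx] at hne ⊢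
      rw [splitConsistentOn_zero_iff, pairTermList_apply]
      exact hu _ _ _ _ hne

/-- The same for the `Y`-blocks. [cite: VassilevskaWilliamsXuXuZhou2024, §6.5] -/
theorem mem_levelBlocksY_pair_iff {I J K : Fin (n + n) → ℕ} (h : IsLevelTriple c I J K)
    (βX βY βZ : Fin s → ℕ × ℕ × ℕ → (Fin c → Fin 3) → ℝ) (Jh : Fin (n + n) → Fin c → Fin 3) :
    Jh ∈ levelBlocksY (pairTermIdx τ h) (pairTermList c s βX βY βZ) 0 ↔ chunkLevels Jh = J ∧ IsUsefulFor₂ τ βY I J K Jh := by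
  rw [levelBlocksY, mem_admissibleSeqs]
  refine and_congr ?_ ?_
  · refine ⟨fun hl => funext fun p => ?_, fun hl p => ?_⟩
    · have := hl p
      rw [show pairTermIdx τ h p = finProdFinEquiv (halfTermOf τ p, tripleTermMap h p) from rfl, pairTermList_apply] at this
      simpa [tripleTermMap] using this
    · rw [show pairTermIdx τ h p = finProdFinEquiv (halfTermOf τ p, tripleTermMap h p) from rfl, pairTermList_apply]
      simpa [tripleTermMap] using congrFun hl p
  · constructor
    · intro hc t i j k hne
      by_cases hijk : i + j + k = 2 * c
      · set sidx := (constituentTriples c).equivFin ⟨(i, j, k), (mem_constituentTriples c).2 hijk⟩ with hsidx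
        have hs : (univ.filter fun p => pairTermIdx τ h p = finProdFinEquiv (t, sidx)) = pairClass τ I J K t i j k := by
          rw [filter_pairTermIdx_eq τ h t sidx]; simp [hsidx]
        have := hc (finProdFinEquiv (t, sidx)) (by rw [hs]; exact hne)
        rw [hs, splitConsistentOn_zero_iff, pairTermList_apply] at this
        simpa [hsidx] using this
      · exfalso
        rw [pairClass_eq_empty τ h hijk] at hne
        exact Finset.not_nonempty_empty hne
    · intro hu idx hne
      obtain ⟨⟨t, sidx⟩, rfl⟩ := finProdFinEquiv.surjective idx
      rw [filter_pairTermIdx_eq τ h t sidx] at hne ⊢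
      rw [splitConsistentOn_zero_iff, pairTermList_apply]
      exact hu _ _ _ _ hne

/-- The same for the `Z`-blocks. [cite: VassilevskaWilliamsXuXuZhou2024, §6.5] -/
theorem mem_levelBlocksZ_pair_iff {I J K : Fin (n + n) → ℕ} (h : IsLevelTriple c I J K)
    (βX βY βZ : Fin s → ℕ × ℕ × ℕ → (Fin c → Fin 3) → ℝ) (Kh : Fin (n + n) → Fin c → Fin 3) :
    Kh ∈ levelBlocksZ (pairTermIdx τ h) (pairTermList c s βX βY βZ) 0 ↔ chunkLevels Kh = K ∧ IsUsefulFor₂ τ βZ I J K Kh := by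
  rw [levelBlocksZ, mem_admissibleSeqs]
  refine and_congr ?_ ?_
  · refine ⟨fun hl => funext fun p => ?_, fun hl p => ?_⟩
    · have := hl p
      rw [show pairTermIdx τ h p = finProdFinEquiv (halfTermOf τ p, tripleTermMap h p) from rfl, pairTermList_apply] at this
      simpa [tripleTermMap] using this
    · rw [show pairTermIdx τ h p = finProdFinEquiv (halfTermOf τ p, tripleTermMap h p) from rfl, pairTermList_apply]
      simpa [tripleTermMap] using congrFun hl p
  · constructor
    · intro hc t i j k hne
      by_cases hijk : i + j + k = 2 * c
      · set sidx := (constituentTriples c).equivFin ⟨(i, j, k), (mem_constituentTriples c).2 hijk⟩ with hsidx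
        have hs : (univ.filter fun p => pairTermIdx τ h p = finProdFinEquiv (t, sidx)) = pairClass τ I J K t i j k := by
          rw [filter_pairTermIdx_eq τ h t sidx]; simp [hsidx]
        have := hc (finProdFinEquiv (t, sidx)) (by rw [hs]; exact hne)
        rw [hs, splitConsistentOn_zero_iff, pairTermList_apply] at this
        simpa [hsidx] using this
      · exfalso
        rw [pairClass_eq_empty τ h hijk] at hne
        exact Finset.not_nonempty_empty hne
    · intro hu idx hne
      obtain ⟨⟨t, sidx⟩, rfl⟩ := finProdFinEquiv.surjective idx
      rw [filter_pairTermIdx_eq τ h t sidx] at hne ⊢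
      rw [splitConsistentOn_zero_iff, pairTermList_apply]
      exact hu _ _ _ _ hne

end Identification

end Literature.Computability.AlgebraicComplexity
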